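import Summits.Schanuel.Schanuel.Theorems.ZilberEacGrowthDensity
import Summits.Schanuel.Schanuel.Theorems.ZilberEacFibrationProj
import Summits.Schanuel.Schanuel.Theorems.ZilberEacComplexPunctureDecoupling
import Literature.ModelTheory.Zilber.EACRotundityProofs
import HarnessLib

/-!
# Density from growth, applied: every puncture-type surface answers Mantova–Masser's question YES

Zilber's Exponential-Algebraic Closedness, case ladder (host summit Schanuel, cell `pub-schanuel`,
seat 2, gen 5).  THEOREM G (`ZilberEacGrowthDensity`) turns the packet's first sub-rung (gen 1,
THEOREM A `exists_expPoint_punctureDecoupling`, here with `s = 1`) into a DENSITY theorem: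

**Theorem** (`unprojectedDense_fibredGraph_one`).  Let `g ∈ ℂ[x₁]` have degree `D ≥ 1` and a lattice
direction `q ∈ ℤ` with `Re g_D(2πiq) < 0`; let `a, b ∈ ℂ` with `a ≠ 0 → q ≠ 0`, `a = 0 → b ≠ 0`, and
`F ∈ ℂ[u, x₁]` arbitrary.  Then the exponential points of the surface
`S = {x₂ = g(x₁), y₁ = a x₁ + b + y₂ F(y₂, x₁)} ⊆ ℂ² × ℂ²` (seat 1's `fibredGraph g a b F`, irreducible of
dimension `2`) are ZARISKI DENSE in `S` (`UnprojectedDense S`).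

Proof.  THEOREM A produces, for every large `m`, an exponential point over `x₁` within `1/2` of
`2πimq + log(a·2πimq + b)`; by the leading-form asymptotics (`ExpDominant.eval_smul_near_top`)
`Re x₂ = Re g(x₁) ≤ -(c₀/2) m^D` while `‖x₂‖ = O(m^D)`, so `|Re x₂| / log(2 + ‖x₂‖) → ∞` and THEOREM G
applies with `j₀ = x₂`.  This extends seat 1's leading-coefficient criterion (`EACDensityFamilies`:
fibres `y₀ = q(y₁)`, i.e. `a = 0`) to affine `A(x₁) = a x₁ + b` and `x₁`-dependent `F`.

Combined with THEOREM F′ (`ZilberEacFibrationProj`): every irreducible 3-fold `W ⊆ ℂ³ × ℂ³` of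
dimension `3` meeting the torus with `dim cl[Δ_2](W ∩ G³) = 2` whose projected surface is such an `S`
meets `Γ_exp`, whatever its fibre curves in `(x₃, y₃)`.

HONEST FRAMING: instances of an OPEN question (MM24 §1); `EC(3,2)` OPEN; nothing here bears on
Schanuel's conjecture (EAC ⇏ SC).
-/

noncomputable section

open MvPolynomial Filter Complex
open Literature.NumberTheory.Transcendental Literature.ModelTheory.Zilber

set_option linter.dupNamespace false

namespace Summit.Schanuel.Schanuel.Theorems

/-- `m / (A + D log m) → ∞` (`A, D ≥ 0`). [folklore] -/
theorem tendsto_div_const_add_mul_log {A D : ℝ} (hA : 0 < A) (hD : 0 ≤ D) :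
    Tendsto (fun m : ℕ => (m : ℝ) / (A + D * Real.log m)) atTop atTop := by
  -- `(A + D log m)/m → 0⁺`
  have h1 : Tendsto (fun r : ℝ => (D * Real.log r + A) / r) atTop (nhds 0) := by
    have := (tendsto_log_add_const_div_atTop (A / D)).const_mul D
    by_cases hD0 : D = 0
    · subst hD0
      simp only [zero_mul, zero_add]
      exact tendsto_const_nhds.div_atTop tendsto_id
    · rw [mul_zero] at this
      refine this.congr' ?_
      filter_upwards [eventually_gt_atTop 0] with r hr
      field_simp
  have h2 : Tendsto (fun m : ℕ => (A + D * Real.log m) / (m : ℝ)) atTop (nhds 0) := by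
    have := h1.comp tendsto_natCast_atTop_atTop
    refine this.congr fun m => ?_
    simp only [Function.comp_apply]
    ring
  have hpos : ∀ᶠ m : ℕ in atTop, 0 < (A + D * Real.log m) / (m : ℝ) := by
    filter_upwards [eventually_gt_atTop 0] with m hm
    have hm' : (0 : ℝ) < m := by exact_mod_cast hm
    exact div_pos (by nlinarith [Real.log_natCast_nonneg m]) hm'
  have h3 : Tendsto (fun m : ℕ => (A + D * Real.log m) / (m : ℝ)) atTop (nhdsWithin 0 (Set.Ioi 0)) :=
    tendsto_nhdsWithin_iff.2 ⟨h2, hpos⟩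
  have h4 := h3.inv_tendsto_nhdsGT_zero
  refine h4.congr fun m => ?_
  simp only [Pi.inv_apply, inv_div]

/-- **Every puncture-type surface answers Mantova–Masser's density question YES.**  For
`g ∈ ℂ[x₁]` of degree `≥ 1` with `Re g_D(2πiq) < 0`, `a ≠ 0 → q ≠ 0`, `a = 0 → b ≠ 0` and any `F`, the
exponential points of `fibredGraph g a b F = {x₂ = g(x₁), y₁ = a x₁ + b + y₂ F(y₂, x₁)}` are Zariski
dense. [cite: MantovaMasser2023, §1 Further remarks] -/
theorem unprojectedDense_fibredGraph_one (g : MvPolynomial (Fin 1) ℂ) (hD : 0 < g.totalDegree)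
    (q : Fin 1 → ℤ)
    (hq : (eval (fun j => 2 * Real.pi * I * (q j : ℂ)) (homogeneousComponent g.totalDegree g)).re < 0)
    (a b : Fin 1 → ℂ) (haq : ∀ j, a j ≠ 0 → q j ≠ 0) (hab : ∀ j, a j = 0 → b j ≠ 0)
    (F : Fin 1 → MvPolynomial (Fin (1 + 1)) ℂ) :
    UnprojectedDense (fibredGraph g a b F) := by
  classical
  obtain ⟨m₀, hsol⟩ := exists_expPoint_punctureDecoupling g hD q hq a b haq hab F
  -- the solutions, as a sequence indexed by all `m` (constant below `m₀`)
  have hsol' : ∀ m : ℕ, ∃ x : Fin 1 → ℂ,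
      ‖x - fun j => ((max m m₀ : ℕ) : ℂ) * (2 * Real.pi * I * (q j : ℂ)) +
          log (a j * (((max m m₀ : ℕ) : ℂ) * (2 * Real.pi * I * (q j : ℂ))) + b j)‖ ≤ 1 / 2 ∧
      ∀ j, exp (x j) = a j * x j + b j +
        exp (eval x g) * eval (Fin.cons (exp (eval x g)) x) (F j) :=
    fun m => hsol (max m m₀) (le_max_right _ _)
  choose xs hxs using hsol'
  -- the exponential points
  set p : ℕ → Fin (1 + 1) ⊕ Fin (1 + 1) → ℂ := fun m =>
    Sum.elim (Fin.snoc (xs m) (eval (xs m) g))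
      (Fin.snoc (fun j => exp (xs m j)) (exp (eval (xs m) g))) with hp
  have hpS : ∀ m, p m ∈ fibredGraph g a b F := by
    intro m
    rw [mem_fibredGraph_iff]
    have h1 : (fun j : Fin 1 => p m (Sum.inl (Fin.castSucc j))) = xs m := by
      funext j; simp only [hp, Sum.elim_inl, Fin.snoc_castSucc]
    refine ⟨?_, fun j => ?_⟩
    · rw [h1]; simp only [hp, Sum.elim_inl, Fin.snoc_last]
    · rw [h1]
      simp only [hp, Sum.elim_inl, Sum.elim_inr, Fin.snoc_castSucc, Fin.snoc_last]
      exact (hxs m).2 j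
  have hpΓ : ∀ m, p m ∈ expGraph ℂ (1 + 1) := by
    intro m
    rw [mem_expGraph_iff]
    intro i
    rw [Literature.ModelTheory.ExponentialFields.ExponentialRing.complex_exp_eq]
    rcases Fin.eq_castSucc_or_eq_last i with ⟨j, rfl⟩ | rfl
    · simp only [hp, Sum.elim_inr, Sum.elim_inl, Fin.snoc_castSucc]
    · simp only [hp, Sum.elim_inr, Sum.elim_inl, Fin.snoc_last]
  have hdim : zariskiDim ℂ (fibredGraph g a b F) ≤ (2 : ℕ) := (zariskiDim_fibredGraph g a b F).le
  refine unprojectedDense_of_growth (isIrreducibleClosed_fibredGraph g a b F) hdim (Fin.last 1)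
    hpS hpΓ ?_
  -- growth of `x₂ = g(x₁)` along the solutions
  have hcoord : ∀ m, p m (Sum.inl (Fin.last 1)) = eval (xs m) g := fun m => by
    simp only [hp, Sum.elim_inl, Fin.snoc_last]
  simp only [hcoord]
  -- constants
  set D := g.totalDegree with hDdef
  set v : Fin 1 → ℂ := fun j => 2 * Real.pi * I * (q j : ℂ) with hv
  set gD := eval v (homogeneousComponent D g) with hgD
  set c₀ : ℝ := -gD.re with hc₀
  have hc₀pos : 0 < c₀ := by rw [hc₀]; linarith
  obtain ⟨ρ, hρ, t₀, ht₀, hnear⟩ := ExpDominant.eval_smul_near_top g v (half_pos hc₀pos)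
  -- `‖log αₘ‖ ≤ (ρ/2) m` eventually
  obtain ⟨μ, -, hαev⟩ := eventually_affineSeq_bounds (haq 0) (hab 0) one_pos (half_pos hρ)
  -- the asymptotic estimate: `Re g(x_m) ≤ -(c₀/2) M^D` and `‖g(x_m)‖ ≤ C₁ M^D`, `M = max m m₀`
  have hest : ∀ᶠ m : ℕ in atTop,
      (eval (xs m) g).re ≤ -(c₀ / 2) * ((max m m₀ : ℕ) : ℝ) ^ D ∧
        ‖eval (xs m) g‖ ≤ (‖gD‖ + c₀ / 2) * ((max m m₀ : ℕ) : ℝ) ^ D := by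
    have hev1 : ∀ᶠ m : ℕ in atTop, m₀ ≤ m := eventually_ge_atTop m₀
    have hev2 : ∀ᶠ m : ℕ in atTop, t₀ ≤ (m : ℝ) := tendsto_natCast_atTop_atTop.eventually_ge_atTop t₀
    have hev3 : ∀ᶠ m : ℕ in atTop, 1 / ρ ≤ (m : ℝ) :=
      tendsto_natCast_atTop_atTop.eventually_ge_atTop (1 / ρ)
    filter_upwards [hev1, hev2, hev3, hαev] with m hm₀ hmt hmρ hα
    have hmax : max m m₀ = m := max_eq_left hm₀
    have hspec := (hxs m).1
    rw [hmax] at hspec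
    rw [hmax]
    have hm0 : (0 : ℝ) < m := lt_of_lt_of_le (by positivity) hmρ
    have hmne : (m : ℂ) ≠ 0 := by exact_mod_cast hm0.ne'
    -- write `x_m = m (v + ζ)` with `‖ζ‖ ≤ ρ`
    set ζ : Fin 1 → ℂ := (m : ℂ)⁻¹ • xs m - v with hζ
    have hxζ : xs m = (m : ℂ) • (v + ζ) := by
      rw [hζ, add_sub_cancel, smul_smul, mul_inv_cancel₀ hmne, one_smul]
    have hζnorm : ‖ζ‖ ≤ ρ := by
      have h1 : ζ = (m : ℂ)⁻¹ • (xs m - (m : ℂ) • v) := by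
        rw [hζ, smul_sub, smul_smul, inv_mul_cancel₀ hmne, one_smul]
      -- `‖x_m - m v‖ ≤ 1/2 + ‖log αₘ‖`
      have h2 : ‖xs m - (m : ℂ) • v‖ ≤ 1 / 2 + ρ / 2 * m := by
        have hsplit : xs m - (m : ℂ) • v =
            (xs m - fun j => (m : ℂ) * (2 * Real.pi * I * (q j : ℂ)) +
              log (a j * ((m : ℂ) * (2 * Real.pi * I * (q j : ℂ))) + b j)) +
            (fun j : Fin 1 => log (a j * ((m : ℂ) * (2 * Real.pi * I * (q j : ℂ))) + b j)) := by
          funext j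
          simp only [hv, Pi.sub_apply, Pi.add_apply, Pi.smul_apply, smul_eq_mul]
          ring
        rw [hsplit]
        refine (norm_add_le _ _).trans (add_le_add hspec ?_)
        rw [pi_norm_le_iff_of_nonneg (by positivity)]
        intro j
        rw [Fin.fin_one_eq_zero j]
        exact hα.2.2
      rw [h1, norm_smul, norm_inv, Complex.norm_natCast]
      calc (m : ℝ)⁻¹ * ‖xs m - (m : ℂ) • v‖ ≤ (m : ℝ)⁻¹ * (1 / 2 + ρ / 2 * m) :=
            mul_le_mul_of_nonneg_left h2 (inv_nonneg.2 hm0.le)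
        _ = (1 / 2) / m + ρ / 2 := by field_simp
        _ ≤ ρ := by
            have h3 : (1 / 2) / (m : ℝ) ≤ ρ / 2 := by
              rw [div_le_iff₀ hm0]
              have : 1 ≤ ρ * m := by rwa [div_le_iff₀ hρ, mul_comm] at hmρ
              linarith
            linarith
    have hkey := hnear m hmt ζ hζnorm
    rw [Complex.ofReal_natCast, ← hxζ] at hkey
    have hre : ((m : ℂ) ^ D * gD).re = (m : ℝ) ^ D * gD.re := by
      rw [← Complex.ofReal_natCast, ← Complex.ofReal_pow, Complex.re_ofReal_mul]
    constructor
    · have h1 := (Complex.abs_re_le_norm (eval (xs m) g - (m : ℂ) ^ D * gD)).trans hkey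
      rw [Complex.sub_re, hre] at h1
      have h2 := (abs_le.1 h1).2
      rw [hc₀]
      nlinarith
    · calc ‖eval (xs m) g‖ ≤ ‖(m : ℂ) ^ D * gD‖ + ‖eval (xs m) g - (m : ℂ) ^ D * gD‖ :=
            norm_le_insert' _ _
        _ ≤ (m : ℝ) ^ D * ‖gD‖ + c₀ / 2 * (m : ℝ) ^ D := by
            rw [norm_mul, norm_pow, Complex.norm_natCast]
            linarith [hkey]
        _ = (‖gD‖ + c₀ / 2) * (m : ℝ) ^ D := by ring
  -- conclude: the ratio dominates `(c₀/2) · m / (A + D log m)`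
  set A : ℝ := Real.log (2 + (‖gD‖ + c₀ / 2)) with hA
  have hApos : 0 < A := Real.log_pos (by linarith [norm_nonneg gD])
  have hlow := (tendsto_div_const_add_mul_log hApos (Nat.cast_nonneg D)).const_mul_atTop
    (half_pos hc₀pos)
  refine tendsto_atTop_mono' atTop ?_ hlow
  filter_upwards [hest, eventually_ge_atTop m₀, eventually_ge_atTop 1] with m hm hm₀ hm1
  obtain ⟨hre, hnorm⟩ := hm
  rw [max_eq_left hm₀] at hre hnorm
  have hm1' : (1 : ℝ) ≤ m := by exact_mod_cast hm1
  have hmD : (m : ℝ) ≤ (m : ℝ) ^ D := by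
    calc (m : ℝ) = (m : ℝ) ^ 1 := (pow_one _).symm
      _ ≤ (m : ℝ) ^ D := pow_le_pow_right₀ hm1' hD
  have hmDpos : 0 < (m : ℝ) ^ D := by positivity
  -- denominator bound: `log (2 + ‖g(x_m)‖) ≤ A + D log m`
  have hden : Real.log (2 + ‖eval (xs m) g‖) ≤ A + D * Real.log m := by
    have h1 : 2 + ‖eval (xs m) g‖ ≤ (2 + (‖gD‖ + c₀ / 2)) * (m : ℝ) ^ D := by
      have : (2 : ℝ) ≤ 2 * (m : ℝ) ^ D := by nlinarith
      nlinarith [norm_nonneg gD]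
    calc Real.log (2 + ‖eval (xs m) g‖) ≤ Real.log ((2 + (‖gD‖ + c₀ / 2)) * (m : ℝ) ^ D) :=
          Real.log_le_log (by linarith [norm_nonneg (eval (xs m) g)]) h1
      _ = A + D * Real.log m := by
          rw [Real.log_mul (by linarith [norm_nonneg gD]) hmDpos.ne', Real.log_pow]
  have hdenpos : 0 < Real.log (2 + ‖eval (xs m) g‖) :=
    Real.log_pos (by linarith [norm_nonneg (eval (xs m) g)])
  have hnum : c₀ / 2 * (m : ℝ) ≤ |(eval (xs m) g).re| := by
    rw [abs_of_nonpos (by nlinarith)]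
    nlinarith
  calc c₀ / 2 * ((m : ℝ) / (A + D * Real.log m))
      = (c₀ / 2 * m) / (A + D * Real.log m) := by ring
    _ ≤ |(eval (xs m) g).re| / (A + D * Real.log m) :=
        div_le_div_of_nonneg_right hnum (by nlinarith [Real.log_natCast_nonneg m])
    _ ≤ |(eval (xs m) g).re| / Real.log (2 + ‖eval (xs m) g‖) :=
        div_le_div_of_nonneg_left (abs_nonneg _) hdenpos hden

/-- **Unconditional members of the fibred periodic piece of `EC(3,2)`.**  Every irreducible
3-fold `W ⊆ ℂ³ × ℂ³` of dimension `3` meeting the torus, with `dim cl[Δ_2](W ∩ G³) = 2` and projected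
surface `cl pr(W ∩ G³)` a puncture-type surface `{x₂ = g(x₁), y₁ = a x₁ + b + y₂ F(y₂, x₁)}`
(`Re g_D(2πiq) < 0`), meets `Γ_exp` — whatever its fibre curves in `(x₃, y₃)` (THEOREM F′ + the
density theorem above). [cite: MantovaMasser2023, §1 Further remarks] -/
theorem inter_expGraph_nonempty_of_projClosure_eq_fibredGraph {W : Set (Fin (2 + 1) ⊕ Fin (2 + 1) → ℂ)}
    (hW : IsIrreducibleClosed ℂ W) (hne : (W ∩ torusLocus ℂ (2 + 1)).Nonempty)
    (hdim : zariskiDim ℂ W = (2 + 1 : ℕ))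
    (hfib : zariskiDim ℂ (matrixAct (dropLastMat 2) '' (W ∩ torusLocus ℂ (2 + 1))) = (2 : ℕ))
    (g : MvPolynomial (Fin 1) ℂ) (hD : 0 < g.totalDegree) (q : Fin 1 → ℤ)
    (hq : (eval (fun j => 2 * Real.pi * I * (q j : ℂ)) (homogeneousComponent g.totalDegree g)).re < 0)
    (a b : Fin 1 → ℂ) (haq : ∀ j, a j ≠ 0 → q j ≠ 0) (hab : ∀ j, a j = 0 → b j ≠ 0)
    (F : Fin 1 → MvPolynomial (Fin (1 + 1)) ℂ)
    (hproj : zeroLocus ℂ (vanishingIdeal ℂ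
      ((fun (w : Fin (2 + 1) ⊕ Fin (2 + 1) → ℂ) (t : Fin 2 ⊕ Fin 2) =>
        w (Sum.map Fin.castSucc Fin.castSucc t)) '' (W ∩ torusLocus ℂ (2 + 1)))) = fibredGraph g a b F) :
    (W ∩ expGraph ℂ (2 + 1)).Nonempty := by
  refine inter_expGraph_nonempty_of_unprojectedDense_proj hW hne hdim (by exact_mod_cast hfib) ?_
  rw [hproj]
  exact unprojectedDense_fibredGraph_one g hD q hq a b haq hab F

end Summit.Schanuel.Schanuel.Theorems
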